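import Literature.Analysis.FunctionSpaces.WightmanFunctions
import Literature.MathematicalPhysics.QuantumFieldTheory.OSLorentzInvariance
import Literature.MathematicalPhysics.QuantumLattice.SchwartzTranslationCutoff
import Mathlib.Geometry.Manifold.PartitionOfUnity
import Mathlib.Analysis.InnerProductSpace.Projection.Reflection
import Mathlib.Analysis.Distribution.SchwartzSpace.Fourier
import Mathlib.Analysis.Distribution.Support
import Mathlib.MeasureTheory.Measure.Lebesgue.EqHaar
import HarnessLib

/-!
# Lorentz invariance upgrades half-space spectral support to the forward cone

Osterwalder–Schrader I (CMP 31 (1973)), §4.1, p. 93: "`W̃ₙ(q₁, …, qₙ)` is a distribution in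
`𝒮′(ℝ^{4n})` with support in `{q₁, …, qₙ : q₁⁰ ≥ 0, …, qₙ⁰ ≥ 0}`. In Section 4.2 we prove that
for `Λ ∈ L↑₊`, `W̃ₙ(Λq₁, …, Λqₙ) = W̃ₙ(q₁, …, qₙ)`. Hence the support of `W̃ₙ` is in
`{q₁, …, qₙ : q₁ ∈ V̄₊, …, qₙ ∈ V̄₊}`, where `V̄₊` is the forward light cone. This is the spectrum
condition (R5)." This file proves the "Hence": for a tempered distribution `T` on
`(ℝ^{1+d})ⁿ`, `d ≥ 1`, invariant under the restricted Lorentz group `L↑₊` acting diagonally (as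
in the Streater–Wightman axiom (a), `IsPoincareInvariantFamily`), Fourier support in the
*half-space spectral set* (total momentum zero, all partial sums with non-negative energy,
`halfSpectralSet`) implies Fourier support in the spectral set of Streater–Wightman (3-13)
(`spectralSet`: partial sums in `V̄₊`), in the test-function form used by `HasSpectralCondition`
(`fourierSupportedIn_spectralSet_of_lorentzInvariant`,
`WightmanFamily.hasSpectralCondition_of_halfSpace`).

Proof. (1) *Transport*: for `G = F ∘ Λ⁻¹` (diagonal action) the Fourier transform of the
flattening is `𝓕G̃ = 𝓕F̃ ∘ Λ̃†` with `Λ† = P Λ⁻¹ P` the Euclidean adjoint (`P` = space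
inversion), because `Λ̃` preserves Lebesgue measure (`|det Λ| = 1`); `Λ†` is again in `L↑₊`, so
invariance moves the vanishing set of `𝓕`-side supports by every `Λ ∈ L↑₊`
(`apply_eq_zero_of_disjoint_image`). (2) *Geometry*: if a partial sum `P` has `P⁰ ≥ 0` but
`P ∉ V̄₊`, a **rotation** taking `P⃗` to `±‖P⃗‖ e₁` (a product of two hyperplane reflections,
`Submodule.reflection`, `reflection_sub`, `det_reflection`; none is needed when `P⃗ ∈ ℝ e₁`)
followed by a boost of rapidity `∓χ`, `e^{2χ} < (‖P⃗‖ − P⁰)/(‖P⃗‖ + P⁰)`, makes the energy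
negative (`exists_lorentz_notMem_halfSpectralSet`); properness of boosts and embedded rotations
is proved on the way, **discharging the prelude facts** `Literature.MathematicalPhysics.QuantumLattice.boost_add`,
`Literature.MathematicalPhysics.QuantumLattice.boost_mem_restrictedLorentzGroup` and `Literature.MathematicalPhysics.QuantumLattice.spatialRotation_mem_restrictedLorentzGroup`
(`MinkowskiGeometry`) as `boost_add_holds`, `boost_mem_restrictedLorentzGroup_holds`,
`spatialRotation_mem_restrictedLorentzGroup_holds`. (3) *Sheaf property*: a continuous linear functional
on `𝓢` vanishing on each open set of a family vanishes on the union — finite smooth partitions of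
unity (`SmoothPartitionOfUnity.exists_isSubordinate`) for compactly supported test functions and
density of compact cutoffs in `𝓢` (`Literature.MathematicalPhysics.QuantumLattice.exists_tsupport_subset_inter_closedBall_tendsto`)
in general (`SchwartzMap.isVanishingOn_iUnion`).

## References
* K. Osterwalder, R. Schrader, Axioms for Euclidean Green's functions, CMP 31 (1973), §4.1
  p. 93 and §4.2.
* R. F. Streater, A. S. Wightman, PCT, Spin and Statistics, and All That (1964), §3-3 (3-13).
-/

noncomputable section

open Filter Topology MeasureTheory Set FourierTransform
open scoped InnerProductSpace SchwartzMap RealInnerProductSpace Manifold ContDiff FourierTransform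

/-! ## The sheaf property of continuous linear functionals on `𝓢` -/

section Sheaf

variable {𝕜 : Type*} [RCLike 𝕜]
variable {E' : Type*} [NormedAddCommGroup E'] [NormedSpace ℝ E'] [FiniteDimensional ℝ E']
variable {G : Type*} [NormedAddCommGroup G] [NormedSpace ℝ G] [NormedSpace 𝕜 G]
variable {H : Type*} [AddCommGroup H] [Module 𝕜 H] [TopologicalSpace H]

open Distribution

/-- **Vanishing on a union, compactly supported test functions.** If a continuous linear map `T`
on `𝓢(E', G)` vanishes on each open set `U i` (`Distribution.IsVanishingOn`), then `T φ = 0` for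
every compactly supported `φ` with `tsupport φ ⊆ ⋃ i, U i`: a finite subcover and a smooth
partition of unity subordinate to it split `φ` into finitely many Schwartz functions supported
in single `U i`. [folklore] -/
theorem SchwartzMap.apply_eq_zero_of_hasCompactSupport_of_tsupport_subset {ι : Type*}
    {U : ι → Set E'} (hU : ∀ i, IsOpen (U i)) (T : 𝓢(E', G) →L[𝕜] H)
    (hT : ∀ i, IsVanishingOn T (U i)) {φ : 𝓢(E', G)} (hφ : HasCompactSupport (φ : E' → G))
    (hsub : tsupport (φ : E' → G) ⊆ ⋃ i, U i) : T φ = 0 := by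
  classical
  obtain ⟨t, ht⟩ := hφ.elim_finite_subcover U hU hsub
  have ht' : tsupport (φ : E' → G) ⊆ ⋃ i : t, U i := fun x hx => by
    obtain ⟨i, hi, hx⟩ := mem_iUnion₂.1 (ht hx)
    exact mem_iUnion.2 ⟨⟨i, hi⟩, hx⟩
  obtain ⟨ρ, hρ⟩ := SmoothPartitionOfUnity.exists_isSubordinate (I := 𝓘(ℝ, E')) (M := E')
    (isClosed_tsupport _) (fun i : t => U i) (fun i => hU i) ht'
  have hρs : ∀ i, ContDiff ℝ ∞ (ρ i : E' → ℝ) := fun i =>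
    contMDiff_iff_contDiff.1 (ρ i).contMDiff
  have hgs : ∀ i, ContDiff ℝ ∞ fun x => (ρ i x) • φ x := fun i => (hρs i).smul (φ.smooth _)
  have hgc : ∀ i, HasCompactSupport fun x => (ρ i x) • φ x := fun i => hφ.smul_left
  set ψ : t → 𝓢(E', G) := fun i => (hgc i).toSchwartzMap (hgs i) with hψ_def
  have hψ0 : ∀ i, T (ψ i) = 0 := fun i =>
    hT i (ψ i) ((tsupport_smul_subset_left (fun x => ρ i x) (φ : E' → G)).trans (hρ i))
  have hψx : ∀ i x, ψ i x = ρ i x • φ x := fun i x => rfl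
  have hsum : φ = ∑ i, ψ i := by
    ext x
    rw [sum_apply]
    simp only [hψx]
    by_cases hx : x ∈ tsupport (φ : E' → G)
    · rw [← Finset.sum_smul, ← finsum_eq_sum_of_fintype, ρ.sum_eq_one hx, one_smul]
    · rw [image_eq_zero_of_notMem_tsupport hx]
      simp
  rw [hsum, map_sum]
  exact Finset.sum_eq_zero fun i _ => hψ0 i

/-- **The sheaf property of continuous linear functionals on Schwartz space** (`E'` finite
dimensional): if `T` vanishes on each open set `U i`, it vanishes on `⋃ i, U i`. The compactly
supported case (`apply_eq_zero_of_hasCompactSupport_of_tsupport_subset`) and the density of the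
compact cutoffs `χ(x/R) φ(x)` in `𝓢`, which are supported inside `tsupport φ`
(`Literature.MathematicalPhysics.QuantumLattice.exists_tsupport_subset_inter_closedBall_tendsto`). [folklore] -/
theorem SchwartzMap.isVanishingOn_iUnion [T2Space H] {ι : Type*} {U : ι → Set E'}
    (hU : ∀ i, IsOpen (U i)) (T : 𝓢(E', G) →L[𝕜] H) (hT : ∀ i, IsVanishingOn T (U i)) :
    IsVanishingOn T (⋃ i, U i) := by
  intro φ hφ
  obtain ⟨u, hu, hlim⟩ := Literature.MathematicalPhysics.QuantumLattice.exists_tsupport_subset_inter_closedBall_tendsto φ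
  have h0 : ∀ m, T (u m) = 0 := fun m =>
    SchwartzMap.apply_eq_zero_of_hasCompactSupport_of_tsupport_subset hU T hT
      (IsCompact.of_isClosed_subset (isCompact_closedBall _ _) (isClosed_tsupport _)
        ((hu m).trans inter_subset_right))
      (((hu m).trans inter_subset_left).trans hφ)
  have h1 : Tendsto (fun m => T (u m)) atTop (𝓝 (T φ)) := (T.continuous.tendsto φ).comp hlim
  simp only [h0] at h1
  exact (tendsto_nhds_unique tendsto_const_nhds h1).symm

end Sheaf

/-! ## Fourier transform and measure-preserving linear changes of variables -/

section FourierLinear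

variable {V : Type*} [NormedAddCommGroup V] [InnerProductSpace ℝ V] [FiniteDimensional ℝ V]
  [MeasurableSpace V] [BorelSpace V] {E : Type*} [NormedAddCommGroup E] [NormedSpace ℂ E]

/-- **Fourier transform of a linearly transformed function**: if the continuous linear
automorphism `A` preserves Lebesgue measure and `B` is its Euclidean adjoint
(`⟪A u, w⟫ = ⟪u, B w⟫`), then `𝓕(f ∘ A⁻¹)(w) = 𝓕f(B w)` (the case `|det A| = 1` of the
change-of-variables formula; Mathlib has the isometric case `Real.fourier_comp_linearIsometry`). [folklore] -/
theorem Real.fourier_comp_symm_of_measurePreserving (A : V ≃L[ℝ] V)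
    (hA : MeasurePreserving (A : V → V)) {B : V → V} (hAB : ∀ u w, ⟪A u, w⟫ = ⟪u, B w⟫)
    (f : V → E) (w : V) : 𝓕 (f ∘ A.symm) w = 𝓕 f (B w) := by
  simp only [Real.fourier_eq]
  rw [← hA.integral_comp A.toHomeomorph.measurableEmbedding]
  simp only [Function.comp_apply, ContinuousLinearEquiv.symm_apply_apply, hAB]

/-- Support form: `tsupport 𝓕(f ∘ A⁻¹) = B⁻¹(tsupport 𝓕f)` when moreover `B` is a
homeomorphism. [folklore] -/
theorem Real.tsupport_fourier_comp_symm_of_measurePreserving (A : V ≃L[ℝ] V)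
    (hA : MeasurePreserving (A : V → V)) (B : V ≃L[ℝ] V) (hAB : ∀ u w, ⟪A u, w⟫ = ⟪u, B w⟫)
    (f : V → E) : tsupport (𝓕 (f ∘ A.symm)) = B ⁻¹' tsupport (𝓕 f) := by
  have h : 𝓕 (f ∘ A.symm) = 𝓕 f ∘ B :=
    funext fun w => Real.fourier_comp_symm_of_measurePreserving A hA hAB f w
  rw [h, tsupport, tsupport, Function.support_comp_eq_preimage]
  have hc := B.toHomeomorph.preimage_closure (Function.support (𝓕 f))
  rw [ContinuousLinearEquiv.coe_toHomeomorph] at hc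
  exact hc.symm

end FourierLinear

namespace Literature.MathematicalPhysics.QuantumFieldTheory

variable {d n : ℕ}

/-! ## Parity and the Euclidean adjoint of a Lorentz transformation -/

section Parity

variable (d) in
/-- **Space inversion** `I_s : (x⁰, x⃗) ↦ (x⁰, −x⃗)` (Streater–Wightman (1964), §1-3,
eq. (1-8)), as the embedded spatial isometry `−1` (`spatialRotation`). [cite: StreaterWightman1964, §1-3 eq. (1-8)] -/
def spatialParity : QuantumLattice.SpaceTime d ≃L[ℝ] QuantumLattice.SpaceTime d :=
  QuantumLattice.spatialRotation (LinearIsometryEquiv.neg ℝ (E := EuclideanSpace ℝ (Fin d))).toContinuousLinearEquiv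

/-- `(P x)⁰ = x⁰`. [folklore] -/
@[simp]
theorem spatialParity_apply_zero (x : QuantumLattice.SpaceTime d) : spatialParity d x 0 = x 0 := by
  simp [spatialParity, QuantumLattice.timeC_apply]

/-- `(P x)ⁱ = −xⁱ` for spatial `i`. [folklore] -/
@[simp]
theorem spatialParity_apply_succ (x : QuantumLattice.SpaceTime d) (i : Fin d) : spatialParity d x i.succ = -x i.succ := by
  simp [spatialParity]

/-- `P (P x) = x`. [folklore] -/
@[simp]
theorem spatialParity_spatialParity (x : QuantumLattice.SpaceTime d) : spatialParity d (spatialParity d x) = x := by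
  ext μ
  refine Fin.cases ?_ (fun i => ?_) μ <;> simp

/-- `P * P = 1`. [folklore] -/
theorem spatialParity_mul_spatialParity : spatialParity d * spatialParity d = 1 := by
  apply ContinuousLinearEquiv.ext; funext x
  simp [QuantumLattice.continuousLinearEquiv_mul_apply]

/-- `P⁻¹ = P`. [folklore] -/
theorem spatialParity_inv : (spatialParity d)⁻¹ = spatialParity d :=
  inv_eq_of_mul_eq_one_right spatialParity_mul_spatialParity

/-- Parity is a Lorentz transformation. [folklore] -/
theorem spatialParity_mem_lorentzGroup : spatialParity d ∈ QuantumLattice.lorentzGroup d :=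
  QuantumLattice.spatialRotation_mem_lorentzGroup _

/-- Parity is orthochronous. [folklore] -/
theorem isOrthochronous_spatialParity : QuantumLattice.IsOrthochronous (spatialParity d) :=
  isOrthochronous_spatialRotation _

/-- **The Minkowski form through parity**: `⟪x, P y⟫ = η(x, y)` (Euclidean inner product of
`ℝ^{1+d}`). [folklore] -/
theorem inner_spatialParity_right (x y : QuantumLattice.SpaceTime d) : ⟪x, spatialParity d y⟫ = QuantumLattice.minkowskiForm d x y := by
  rw [QuantumLattice.minkowskiForm_apply, PiLp.inner_apply, Fin.sum_univ_succ, sub_eq_add_neg,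
    ← Finset.sum_neg_distrib]
  congr 1
  · simp [RCLike.inner_apply, mul_comm]
  · exact Finset.sum_congr rfl fun i _ => by simp [RCLike.inner_apply, mul_comm]

/-- The **Euclidean adjoint** of a Lorentz transformation, `Λ† = P Λ⁻¹ P` (from `Λᵀ η Λ = η`,
`η = P` as a matrix). [folklore] -/
def lorentzAdj (Λ : QuantumLattice.SpaceTime d ≃L[ℝ] QuantumLattice.SpaceTime d) : QuantumLattice.SpaceTime d ≃L[ℝ] QuantumLattice.SpaceTime d :=
  spatialParity d * Λ⁻¹ * spatialParity d

variable {Λ : QuantumLattice.SpaceTime d ≃L[ℝ] QuantumLattice.SpaceTime d}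

/-- `⟪Λ u, w⟫ = ⟪u, Λ† w⟫` for Lorentz `Λ`. [folklore] -/
theorem inner_lorentz_left (hΛ : Λ ∈ QuantumLattice.lorentzGroup d) (u w : QuantumLattice.SpaceTime d) :
    ⟪Λ u, w⟫ = ⟪u, lorentzAdj Λ w⟫ := by
  rw [lorentzAdj, QuantumLattice.continuousLinearEquiv_mul_apply, QuantumLattice.continuousLinearEquiv_mul_apply,
    inner_spatialParity_right, ← hΛ u, QuantumLattice.continuousLinearEquiv_apply_inv_apply,
    ← inner_spatialParity_right, spatialParity_spatialParity]

/-- `Λ†` is a Lorentz transformation. [folklore] -/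
theorem lorentzAdj_mem_lorentzGroup (hΛ : Λ ∈ QuantumLattice.lorentzGroup d) : lorentzAdj Λ ∈ QuantumLattice.lorentzGroup d :=
  (QuantumLattice.lorentzGroup d).mul_mem ((QuantumLattice.lorentzGroup d).mul_mem spatialParity_mem_lorentzGroup
    ((QuantumLattice.lorentzGroup d).inv_mem hΛ)) spatialParity_mem_lorentzGroup

/-- `Λ†` is orthochronous if `Λ` is. [folklore] -/
theorem isOrthochronous_lorentzAdj (hΛ : Λ ∈ QuantumLattice.lorentzGroup d) (ho : QuantumLattice.IsOrthochronous Λ) :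
    QuantumLattice.IsOrthochronous (lorentzAdj Λ) :=
  ((isOrthochronous_spatialParity.mul spatialParity_mem_lorentzGroup ((QuantumLattice.lorentzGroup d).inv_mem hΛ)
    (ho.inv hΛ)).mul ((QuantumLattice.lorentzGroup d).mul_mem spatialParity_mem_lorentzGroup
      ((QuantumLattice.lorentzGroup d).inv_mem hΛ)) spatialParity_mem_lorentzGroup isOrthochronous_spatialParity)

/-- `Λ†† = Λ`. [folklore] -/
theorem lorentzAdj_lorentzAdj (Λ : QuantumLattice.SpaceTime d ≃L[ℝ] QuantumLattice.SpaceTime d) : lorentzAdj (lorentzAdj Λ) = Λ := by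
  simp only [lorentzAdj, mul_inv_rev, spatialParity_inv, inv_inv, mul_assoc, spatialParity_mul_spatialParity,
    mul_one]
  rw [← mul_assoc, spatialParity_mul_spatialParity, one_mul]

end Parity

/-! ## Properness of boosts, embedded rotations and adjoints (three prelude facts discharged) -/

section Proper

/-- **Boosts in a fixed direction form a one-parameter group**, `B(χ + χ') = B(χ) B(χ')`
(addition theorems for `cosh`, `sinh`): discharge of the prelude fact `Literature.MathematicalPhysics.QuantumLattice.boost_add`
(`MinkowskiGeometry`). [cite: StreaterWightman1964, §1-3] -/
theorem boost_add_holds : QuantumLattice.boost_add (d := d) := by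
  intro i χ χ'
  apply ContinuousLinearEquiv.ext
  funext x
  ext j
  rw [QuantumLattice.continuousLinearEquiv_mul_apply]
  simp only [QuantumLattice.boost_apply, QuantumLattice.boostLin_apply, Real.cosh_add, Real.sinh_add]
  by_cases h0 : j = 0
  · subst h0
    simp only [if_true, Fin.succ_ne_zero, if_false]
    ring
  · by_cases hi : j = i.succ
    · subst hi
      simp only [Fin.succ_ne_zero, if_false, if_true]
      ring
    · simp only [h0, hi, if_false]

/-- **Boosts are proper**: `det B(χ) = 1`, since `B(χ) = B(χ/2)²` has non-negative determinant
and `|det| = 1` on the Lorentz group. [cite: StreaterWightman1964, §1-3] -/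
theorem isProper_boost (i : Fin d) (χ : ℝ) : QuantumLattice.IsProper (QuantumLattice.boost i χ) := by
  have hsq : QuantumLattice.boost i χ = QuantumLattice.boost i (χ / 2) * QuantumLattice.boost i (χ / 2) := by
    rw [← boost_add_holds, add_halves]
  rw [QuantumLattice.isProper_iff_mem_ker, MonoidHom.mem_ker, hsq, map_mul]
  have habs : |QuantumLattice.detHom d (QuantumLattice.boost i (χ / 2))| = 1 :=
    abs_det_eq_one_of_mem_lorentzGroup (boost_mem_lorentzGroup i _)
  rw [← sq, ← sq_abs, habs, one_pow]

/-- **Boosts are restricted Lorentz transformations**: discharge of the prelude fact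
`Literature.MathematicalPhysics.QuantumLattice.boost_mem_restrictedLorentzGroup` (`MinkowskiGeometry`). [cite: StreaterWightman1964, §1-3] -/
theorem boost_mem_restrictedLorentzGroup_holds : QuantumLattice.boost_mem_restrictedLorentzGroup (d := d) :=
  fun i χ => (QuantumLattice.mem_restrictedLorentzGroup_iff _).2
    ⟨boost_mem_lorentzGroup i χ, isOrthochronous_boost i χ, isProper_boost i χ⟩

variable (d) in
/-- The splitting `ℝ^{1+d} ≃ ℝ × ℝ^d`, `x ↦ (x⁰, x⃗)` (inverse `ofTimeSpace`). [folklore] -/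
def timeSpaceEquiv : QuantumLattice.SpaceTime d ≃ₗ[ℝ] ℝ × EuclideanSpace ℝ (Fin d) where
  toFun x := (x 0, QuantumLattice.spaceC d x)
  invFun p := QuantumLattice.ofTimeSpace p.1 p.2
  map_add' x y := by simp
  map_smul' c x := by simp
  left_inv x := QuantumLattice.ofTimeSpace_apply_zero_spaceC x
  right_inv p := by simp

/-- **The determinant of an embedded spatial map is the spatial determinant**:
`det (1 ⊕ R) = det R` (conjugate to `LinearMap.prodMap id R` by `timeSpaceEquiv`). [folklore] -/
theorem det_spatialRotation (R : EuclideanSpace ℝ (Fin d) ≃L[ℝ] EuclideanSpace ℝ (Fin d)) :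
    LinearMap.det ((QuantumLattice.spatialRotation R : QuantumLattice.SpaceTime d →L[ℝ] QuantumLattice.SpaceTime d) : QuantumLattice.SpaceTime d →ₗ[ℝ] QuantumLattice.SpaceTime d) =
      LinearMap.det ((R : EuclideanSpace ℝ (Fin d) →L[ℝ] EuclideanSpace ℝ (Fin d)) :
        EuclideanSpace ℝ (Fin d) →ₗ[ℝ] EuclideanSpace ℝ (Fin d)) := by
  set e := (timeSpaceEquiv d).symm with he
  have h : ((QuantumLattice.spatialRotation R : QuantumLattice.SpaceTime d →L[ℝ] QuantumLattice.SpaceTime d) : QuantumLattice.SpaceTime d →ₗ[ℝ] QuantumLattice.SpaceTime d) =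
      (e : ℝ × EuclideanSpace ℝ (Fin d) →ₗ[ℝ] QuantumLattice.SpaceTime d) ∘ₗ
        LinearMap.prodMap LinearMap.id
          ((R : EuclideanSpace ℝ (Fin d) →L[ℝ] EuclideanSpace ℝ (Fin d)) :
            EuclideanSpace ℝ (Fin d) →ₗ[ℝ] EuclideanSpace ℝ (Fin d)) ∘ₗ
        (e.symm : QuantumLattice.SpaceTime d →ₗ[ℝ] ℝ × EuclideanSpace ℝ (Fin d)) := by
    apply LinearMap.ext
    intro x
    rfl
  rw [h, LinearMap.det_conj, LinearMap.det_prodMap, LinearMap.det_id, one_mul]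

/-- **Embedded rotations are restricted Lorentz transformations** (`R ∈ SO(d)`): discharge of the
prelude fact `Literature.MathematicalPhysics.QuantumLattice.spatialRotation_mem_restrictedLorentzGroup` (`MinkowskiGeometry`). [cite: StreaterWightman1964, §1-3] -/
theorem spatialRotation_mem_restrictedLorentzGroup_holds :
    QuantumLattice.spatialRotation_mem_restrictedLorentzGroup (d := d) := fun R hR =>
  (QuantumLattice.mem_restrictedLorentzGroup_iff _).2 ⟨QuantumLattice.spatialRotation_mem_lorentzGroup R,
    isOrthochronous_spatialRotation _, by rw [QuantumLattice.IsProper, det_spatialRotation]; exact hR⟩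

variable {Λ : QuantumLattice.SpaceTime d ≃L[ℝ] QuantumLattice.SpaceTime d}

/-- `Λ† = P Λ⁻¹ P` is proper if `Λ` is (`(det P)² = 1`). [folklore] -/
theorem isProper_lorentzAdj (hp : QuantumLattice.IsProper Λ) : QuantumLattice.IsProper (lorentzAdj Λ) := by
  rw [QuantumLattice.isProper_iff_mem_ker, MonoidHom.mem_ker] at hp ⊢
  rw [lorentzAdj, map_mul, map_mul, map_inv, hp, inv_one, mul_one]
  have habs : |QuantumLattice.detHom d (spatialParity d)| = 1 :=
    abs_det_eq_one_of_mem_lorentzGroup spatialParity_mem_lorentzGroup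
  rw [← sq, ← sq_abs, habs, one_pow]

/-- `Λ ∈ L↑₊ ⇒ Λ† ∈ L↑₊`. [folklore] -/
theorem lorentzAdj_mem_restrictedLorentzGroup (h : Λ ∈ QuantumLattice.restrictedLorentzGroup d) :
    lorentzAdj Λ ∈ QuantumLattice.restrictedLorentzGroup d := by
  rw [QuantumLattice.mem_restrictedLorentzGroup_iff] at h ⊢
  exact ⟨lorentzAdj_mem_lorentzGroup h.1, isOrthochronous_lorentzAdj h.1 h.2.1, isProper_lorentzAdj h.2.2⟩

/-- **Every nonzero vector is rotated to `±‖v‖ e₁` by an element of `SO(d)`** (`d ≥ 1`): the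
identity if `v ∈ ℝ e₁`; otherwise `d ≥ 2` and the product of the hyperplane reflection taking
`v/‖v‖` to `e₁` (`reflection_sub`) with the reflection in `e₂ᗮ` (which fixes `e₁`) has
determinant `(−1)² = 1` (`det_reflection`). [folklore] -/
theorem exists_det_eq_one_map_eq_smul_single [NeZero d] {v : EuclideanSpace ℝ (Fin d)} (hv : v ≠ 0) :
    ∃ R : EuclideanSpace ℝ (Fin d) ≃ₗᵢ[ℝ] EuclideanSpace ℝ (Fin d),
      LinearMap.det (R.toLinearEquiv : EuclideanSpace ℝ (Fin d) →ₗ[ℝ] EuclideanSpace ℝ (Fin d)) = 1 ∧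
        (R v = ‖v‖ • EuclideanSpace.single (0 : Fin d) 1 ∨
          R v = -(‖v‖ • EuclideanSpace.single (0 : Fin d) 1)) := by
  set e : EuclideanSpace ℝ (Fin d) := EuclideanSpace.single (0 : Fin d) 1 with he
  set r : ℝ := ‖v‖ with hr
  have hr0 : 0 < r := norm_pos_iff.2 hv
  set u : EuclideanSpace ℝ (Fin d) := r⁻¹ • v with hu
  have he1 : ‖e‖ = 1 := by simp [he]
  have hue : ‖u‖ = ‖e‖ := by
    rw [he1, hu, norm_smul, norm_inv, Real.norm_of_nonneg hr0.le, ← hr, inv_mul_cancel₀ hr0.ne']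
  have hvu : v = r • u := by rw [hu, smul_smul, mul_inv_cancel₀ hr0.ne', one_smul]
  by_cases hcase : u = e ∨ u = -e
  · refine ⟨LinearIsometryEquiv.refl ℝ _, ?_, ?_⟩
    · change LinearMap.det (LinearMap.id : EuclideanSpace ℝ (Fin d) →ₗ[ℝ] _) = 1
      exact LinearMap.det_id
    · rcases hcase with h | h
      · left; rw [LinearIsometryEquiv.coe_refl, id, hvu, h]
      · right; rw [LinearIsometryEquiv.coe_refl, id, hvu, h, smul_neg]
  · -- `u ∉ {±e}` forces a second axis
    push Not at hcase
    obtain ⟨i₁, hi₁⟩ : ∃ i₁ : Fin d, i₁ ≠ 0 := by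
      by_contra hall
      push Not at hall
      have hue' : u = u 0 • e := by
        ext j
        obtain rfl := hall j
        simp [he]
      have habs : |u 0| = 1 := by
        have := hue
        rw [hue', norm_smul, he1, mul_one, Real.norm_eq_abs] at this
        exact this
      rcases abs_eq_abs.1 (habs.trans (abs_one).symm) with h1 | h1
      · exact hcase.1 (by rw [hue', h1, one_smul])
      · exact hcase.2 (by rw [hue', h1, neg_one_smul])
    set e' : EuclideanSpace ℝ (Fin d) := EuclideanSpace.single i₁ 1 with he'
    have he'0 : e' ≠ 0 := fun h => by
      have := congrArg (fun w : EuclideanSpace ℝ (Fin d) => w i₁) h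
      simp [he'] at this
    have hue0 : u - e ≠ 0 := sub_ne_zero.2 hcase.1
    set R₀ : EuclideanSpace ℝ (Fin d) ≃ₗᵢ[ℝ] EuclideanSpace ℝ (Fin d) := (ℝ ∙ (u - e))ᗮ.reflection with hR₀
    set R₁ : EuclideanSpace ℝ (Fin d) ≃ₗᵢ[ℝ] EuclideanSpace ℝ (Fin d) := (ℝ ∙ e')ᗮ.reflection with hR₁
    have hR₀u : R₀ u = e := Submodule.reflection_sub hue
    have hR₁e : R₁ e = e := by
      refine Submodule.reflection_mem_subspace_eq_self ?_
      rw [Submodule.mem_orthogonal_singleton_iff_inner_right, he', he, EuclideanSpace.inner_single_left]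
      simp [hi₁.symm]
    have hdet : ∀ {w : EuclideanSpace ℝ (Fin d)}, w ≠ 0 →
        LinearMap.det ((ℝ ∙ w)ᗮ.reflection.toLinearEquiv :
          EuclideanSpace ℝ (Fin d) →ₗ[ℝ] EuclideanSpace ℝ (Fin d)) = -1 := fun {w} hw => by
      rw [show ((ℝ ∙ w)ᗮ.reflection.toLinearEquiv : EuclideanSpace ℝ (Fin d) →ₗ[ℝ] _) =
        (ℝ ∙ w)ᗮ.reflection.toLinearMap from rfl, Submodule.det_reflection,
        Submodule.orthogonal_orthogonal, finrank_span_singleton hw, pow_one]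
    refine ⟨R₀.trans R₁, ?_, Or.inl ?_⟩
    · have : ((R₀.trans R₁).toLinearEquiv : EuclideanSpace ℝ (Fin d) →ₗ[ℝ] EuclideanSpace ℝ (Fin d)) =
          (R₁.toLinearEquiv : EuclideanSpace ℝ (Fin d) →ₗ[ℝ] EuclideanSpace ℝ (Fin d)) ∘ₗ
            (R₀.toLinearEquiv : EuclideanSpace ℝ (Fin d) →ₗ[ℝ] EuclideanSpace ℝ (Fin d)) :=
        LinearMap.ext fun x => rfl
      rw [this, LinearMap.det_comp, hR₁, hdet he'0, hR₀, hdet hue0]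
      norm_num
    · rw [LinearIsometryEquiv.trans_apply, hvu, map_smul, map_smul, hR₀u, hR₁e]

end Proper

/-! ## The flattened diagonal action and its Fourier transform -/

section Flat

/-- The diagonal action of `Λ` on `n`-point configurations, transported to the flattening
`ℝ^{n(1+d)}` (an inner-product space, where Mathlib's `𝓕` lives). [folklore] -/
def flatLorentz (n : ℕ) (Λ : QuantumLattice.SpaceTime d ≃L[ℝ] QuantumLattice.SpaceTime d) :
    EuclideanSpace ℝ (Fin n × Fin (d + 1)) ≃L[ℝ] EuclideanSpace ℝ (Fin n × Fin (d + 1)) :=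
  ((Literature.Analysis.FunctionSpaces.flattenCLE d n).symm.trans (QuantumLattice.lorentzDiag n Λ)).trans (Literature.Analysis.FunctionSpaces.flattenCLE d n)

/-- Pointwise formula. [folklore] -/
theorem flatLorentz_apply (Λ : QuantumLattice.SpaceTime d ≃L[ℝ] QuantumLattice.SpaceTime d)
    (w : EuclideanSpace ℝ (Fin n × Fin (d + 1))) :
    flatLorentz n Λ w = Literature.Analysis.FunctionSpaces.flattenCLE d n (fun k => Λ ((Literature.Analysis.FunctionSpaces.flattenCLE d n).symm w k)) := rfl

/-- `Λ̃ (flatten x) = flatten (Λ • x)`. [folklore] -/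
theorem flatLorentz_flattenCLE (Λ : QuantumLattice.SpaceTime d ≃L[ℝ] QuantumLattice.SpaceTime d) (x : Fin n → QuantumLattice.SpaceTime d) :
    flatLorentz n Λ (Literature.Analysis.FunctionSpaces.flattenCLE d n x) = Literature.Analysis.FunctionSpaces.flattenCLE d n (fun k => Λ (x k)) := by
  rw [flatLorentz_apply, ContinuousLinearEquiv.symm_apply_apply]

/-- `Λ̃⁻¹ = (Λ⁻¹)̃`. [folklore] -/
theorem flatLorentz_symm_apply (Λ : QuantumLattice.SpaceTime d ≃L[ℝ] QuantumLattice.SpaceTime d)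
    (w : EuclideanSpace ℝ (Fin n × Fin (d + 1))) :
    (flatLorentz n Λ).symm w = Literature.Analysis.FunctionSpaces.flattenCLE d n (fun k => Λ.symm ((Literature.Analysis.FunctionSpaces.flattenCLE d n).symm w k)) := rfl

/-- The inner product of flattenings: `⟪x̃, ỹ⟫ = ∑ₖ ⟪xₖ, yₖ⟫`. [folklore] -/
theorem inner_flattenCLE (x y : Fin n → QuantumLattice.SpaceTime d) :
    ⟪Literature.Analysis.FunctionSpaces.flattenCLE d n x, Literature.Analysis.FunctionSpaces.flattenCLE d n y⟫ = ∑ k, ⟪x k, y k⟫ := by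
  simp only [PiLp.inner_apply, Literature.Analysis.FunctionSpaces.flattenCLE_apply, Fintype.sum_prod_type]

/-- `⟪Λ̃ u, w⟫ = ⟪u, (Λ†)̃ w⟫`. [folklore] -/
theorem inner_flatLorentz_left {Λ : QuantumLattice.SpaceTime d ≃L[ℝ] QuantumLattice.SpaceTime d} (hΛ : Λ ∈ QuantumLattice.lorentzGroup d)
    (u w : EuclideanSpace ℝ (Fin n × Fin (d + 1))) :
    ⟪flatLorentz n Λ u, w⟫ = ⟪u, flatLorentz n (lorentzAdj Λ) w⟫ := by
  conv_lhs => rw [← (Literature.Analysis.FunctionSpaces.flattenCLE d n).apply_symm_apply w]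
  conv_rhs => rw [← (Literature.Analysis.FunctionSpaces.flattenCLE d n).apply_symm_apply u]
  rw [flatLorentz_apply, flatLorentz_apply, inner_flattenCLE, inner_flattenCLE]
  exact Finset.sum_congr rfl fun k _ => inner_lorentz_left hΛ _ _

/-- The determinant of the flattened diagonal action is `(det Λ)ⁿ`. [folklore] -/
theorem det_flatLorentz (Λ : QuantumLattice.SpaceTime d ≃L[ℝ] QuantumLattice.SpaceTime d) :
    LinearMap.det ((flatLorentz n Λ).toLinearEquiv :
        EuclideanSpace ℝ (Fin n × Fin (d + 1)) →ₗ[ℝ] EuclideanSpace ℝ (Fin n × Fin (d + 1))) =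
      LinearMap.det ((Λ : QuantumLattice.SpaceTime d →L[ℝ] QuantumLattice.SpaceTime d) : QuantumLattice.SpaceTime d →ₗ[ℝ] QuantumLattice.SpaceTime d) ^ n := by
  have h1 : ((flatLorentz n Λ).toLinearEquiv :
        EuclideanSpace ℝ (Fin n × Fin (d + 1)) →ₗ[ℝ] EuclideanSpace ℝ (Fin n × Fin (d + 1))) =
      ((Literature.Analysis.FunctionSpaces.flattenCLE d n).toLinearEquiv : (Fin n → QuantumLattice.SpaceTime d) →ₗ[ℝ] _) ∘ₗ
        (LinearMap.pi fun k : Fin n =>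
          ((Λ : QuantumLattice.SpaceTime d →L[ℝ] QuantumLattice.SpaceTime d) : QuantumLattice.SpaceTime d →ₗ[ℝ] QuantumLattice.SpaceTime d) ∘ₗ
            LinearMap.proj k) ∘ₗ
        ((Literature.Analysis.FunctionSpaces.flattenCLE d n).toLinearEquiv.symm : _ →ₗ[ℝ] (Fin n → QuantumLattice.SpaceTime d)) := by
    apply LinearMap.ext; intro w; rfl
  rw [h1, LinearMap.det_conj, LinearMap.det_pi, Finset.prod_const, Finset.card_univ,
    Fintype.card_fin]

/-- The flattened diagonal action of a Lorentz transformation preserves Lebesgue measure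
(`|det Λ| = 1`). [folklore] -/
theorem measurePreserving_flatLorentz {Λ : QuantumLattice.SpaceTime d ≃L[ℝ] QuantumLattice.SpaceTime d}
    (hΛ : Λ ∈ QuantumLattice.lorentzGroup d) :
    MeasurePreserving (flatLorentz n Λ : EuclideanSpace ℝ (Fin n × Fin (d + 1)) → _) := by
  set l : EuclideanSpace ℝ (Fin n × Fin (d + 1)) →ₗ[ℝ] EuclideanSpace ℝ (Fin n × Fin (d + 1)) :=
    ((flatLorentz n Λ).toLinearEquiv :
      EuclideanSpace ℝ (Fin n × Fin (d + 1)) →ₗ[ℝ] EuclideanSpace ℝ (Fin n × Fin (d + 1)))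
  have habs : |LinearMap.det l| = 1 := by
    rw [det_flatLorentz, abs_pow, abs_det_eq_one_of_mem_lorentzGroup hΛ, one_pow]
  have hdet : LinearMap.det l ≠ 0 := fun h => by
    rw [h, abs_zero] at habs
    exact zero_ne_one habs
  refine ⟨(flatLorentz n Λ).continuous.measurable, ?_⟩
  have hmap := Measure.map_linearMap_addHaar_eq_smul_addHaar
    (μ := (volume : Measure (EuclideanSpace ℝ (Fin n × Fin (d + 1))))) hdet
  rw [abs_inv, habs, inv_one, ENNReal.ofReal_one, one_smul] at hmap
  exact hmap

/-- **Fourier transform of a Lorentz-transformed test function** (support form): for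
`G(x) = F(Λ⁻¹x₁, …, Λ⁻¹xₙ)`, `tsupport 𝓕G̃ = ((Λ†)̃)⁻¹ (tsupport 𝓕F̃)`. [folklore] -/
theorem tsupport_fourier_flattenTest_lorentz {Λ : QuantumLattice.SpaceTime d ≃L[ℝ] QuantumLattice.SpaceTime d}
    (hΛ : Λ ∈ QuantumLattice.lorentzGroup d) {F G : 𝓢((Fin n → QuantumLattice.SpaceTime d), ℂ)}
    (hG : ∀ x, G x = F fun k => Λ.symm (x k)) :
    tsupport ((𝓕 (Literature.Analysis.FunctionSpaces.flattenTest G) : 𝓢(EuclideanSpace ℝ (Fin n × Fin (d + 1)), ℂ)) : _ → ℂ) =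
      flatLorentz n (lorentzAdj Λ) ⁻¹'
        tsupport ((𝓕 (Literature.Analysis.FunctionSpaces.flattenTest F) : 𝓢(EuclideanSpace ℝ (Fin n × Fin (d + 1)), ℂ)) : _ → ℂ) := by
  have hfun : ((Literature.Analysis.FunctionSpaces.flattenTest G : 𝓢(EuclideanSpace ℝ (Fin n × Fin (d + 1)), ℂ)) : _ → ℂ) =
      ((Literature.Analysis.FunctionSpaces.flattenTest F : 𝓢(EuclideanSpace ℝ (Fin n × Fin (d + 1)), ℂ)) : _ → ℂ) ∘
        (flatLorentz n Λ).symm := by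
    funext w
    simp only [Function.comp_apply, Literature.Analysis.FunctionSpaces.flattenTest_apply, flatLorentz_symm_apply,
      ContinuousLinearEquiv.symm_apply_apply, hG]
  rw [SchwartzMap.fourier_coe, SchwartzMap.fourier_coe, hfun]
  exact Real.tsupport_fourier_comp_symm_of_measurePreserving (flatLorentz n Λ)
    (measurePreserving_flatLorentz hΛ) (flatLorentz n (lorentzAdj Λ))
    (inner_flatLorentz_left hΛ) _

end Flat

/-! ## Fourier support in a set, and its transport under Lorentz invariance -/

section Support

/-- **The Fourier transform of `T` is supported in `K`** (test-function form, as in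
`HasSpectralCondition`): `T F = 0` whenever the Fourier transform of the flattening of `F` has
support disjoint from (the flattening of) `K`. `HasSpectralCondition 𝒲` is literally
`∀ n k, FourierSupportedIn (𝒲 n k) (spectralSet d n)` (`hasSpectralCondition_iff`). [folklore] -/
def FourierSupportedIn (T : 𝓢((Fin n → QuantumLattice.SpaceTime d), ℂ) →L[ℂ] ℂ) (K : Set (Fin n → QuantumLattice.SpaceTime d)) :
    Prop :=
  ∀ F : 𝓢((Fin n → QuantumLattice.SpaceTime d), ℂ),
    Disjoint (tsupport (⇑(SchwartzMap.fourierTransformCLM ℂ (Literature.Analysis.FunctionSpaces.flattenTest F))))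
        (Literature.Analysis.FunctionSpaces.flattenCLE d n '' K) →
      T F = 0

/-- `HasSpectralCondition` unfolded through `FourierSupportedIn`. [folklore] -/
theorem _root_.Literature.Analysis.FunctionSpaces.WightmanFamily.hasSpectralCondition_iff {κ : Type*} (𝒲 : Literature.Analysis.FunctionSpaces.WightmanFamily d κ) :
    Literature.Analysis.FunctionSpaces.HasSpectralCondition 𝒲 ↔ ∀ (n : ℕ) (k : Fin n → κ), FourierSupportedIn (𝒲 n k) (Literature.Analysis.FunctionSpaces.spectralSet d n) :=
  Iff.rfl

/-- Monotonicity in the set. [folklore] -/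
theorem FourierSupportedIn.mono {T : 𝓢((Fin n → QuantumLattice.SpaceTime d), ℂ) →L[ℂ] ℂ}
    {K K' : Set (Fin n → QuantumLattice.SpaceTime d)} (h : FourierSupportedIn T K) (hKK' : K ⊆ K') :
    FourierSupportedIn T K' := fun F hF =>
  h F (hF.mono_right (image_mono hKK'))

/-- **Diagonal invariance under the restricted Lorentz group `L↑₊`** of a tempered distribution
on `(ℝ^{1+d})ⁿ` (witness form: `T G = T F` whenever `G = F ∘ Λ⁻¹`, `Λ ∈ L↑₊`); this is the
Lorentz part of the Streater–Wightman axiom (a) (`IsPoincareInvariantFamily.isLorentzInvariantDistribution`). [folklore] -/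
def IsLorentzInvariantDistribution (T : 𝓢((Fin n → QuantumLattice.SpaceTime d), ℂ) →L[ℂ] ℂ) : Prop :=
  ∀ ⦃Λ : QuantumLattice.SpaceTime d ≃L[ℝ] QuantumLattice.SpaceTime d⦄, Λ ∈ QuantumLattice.restrictedLorentzGroup d →
    ∀ F G : 𝓢((Fin n → QuantumLattice.SpaceTime d), ℂ), (∀ x, G x = F fun k => Λ.symm (x k)) → T G = T F

/-- Axiom (a) gives `IsLorentzInvariantDistribution` for every component. [folklore] -/
theorem _root_.Literature.Analysis.FunctionSpaces.WightmanFamily.IsPoincareInvariantFamily.isLorentzInvariantDistribution {κ : Type*}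
    {𝒲 : Literature.Analysis.FunctionSpaces.WightmanFamily d κ} (h : Literature.Analysis.FunctionSpaces.IsPoincareInvariantFamily 𝒲) (n : ℕ) (k : Fin n → κ) :
    IsLorentzInvariantDistribution (𝒲 n k) := by
  intro Λ hΛ F G hG
  have hG' : G = QuantumLattice.poincareTestMulti n (SemidirectProduct.inr ⟨Λ, hΛ⟩) F := by
    ext x
    rw [hG x, QuantumLattice.poincareTestMulti_apply]
    simp
  rw [hG']
  exact h _ n k F

/-- **Transport of Fourier support under Lorentz invariance**: if `T` is invariant and has Fourier
support in `K`, then `T F = 0` as soon as `tsupport 𝓕F̃` misses the flattening of `M • K`, for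
every `M ∈ L↑₊` (apply invariance with `Λ = M† ∈ L↑₊`, whose adjoint is `M`). [folklore] -/
theorem FourierSupportedIn.apply_eq_zero_of_disjoint_image
    {T : 𝓢((Fin n → QuantumLattice.SpaceTime d), ℂ) →L[ℂ] ℂ} {K : Set (Fin n → QuantumLattice.SpaceTime d)}
    (hK : FourierSupportedIn T K) (hT : IsLorentzInvariantDistribution T)
    {M : QuantumLattice.SpaceTime d ≃L[ℝ] QuantumLattice.SpaceTime d} (hM : M ∈ QuantumLattice.restrictedLorentzGroup d)
    (F : 𝓢((Fin n → QuantumLattice.SpaceTime d), ℂ))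
    (hF : Disjoint (tsupport (⇑(SchwartzMap.fourierTransformCLM ℂ (Literature.Analysis.FunctionSpaces.flattenTest F))))
      (Literature.Analysis.FunctionSpaces.flattenCLE d n '' ((fun q k => M (q k)) '' K))) :
    T F = 0 := by
  set Λ := lorentzAdj M with hΛ_def
  have hΛ : Λ ∈ QuantumLattice.restrictedLorentzGroup d := lorentzAdj_mem_restrictedLorentzGroup hM
  set G : 𝓢((Fin n → QuantumLattice.SpaceTime d), ℂ) :=
    SchwartzMap.compCLMOfContinuousLinearEquiv ℂ (QuantumLattice.lorentzDiag n Λ.symm) F with hG_def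
  have hG : ∀ x, G x = F fun k => Λ.symm (x k) := fun x => rfl
  rw [← hT hΛ F G hG]
  refine hK G ?_
  rw [SchwartzMap.fourierTransformCLM_apply,
    tsupport_fourier_flattenTest_lorentz (QuantumLattice.restrictedLorentzGroup_le_lorentzGroup hΛ) hG,
    lorentzAdj_lorentzAdj]
  refine Set.disjoint_left.2 fun w hw hw' => ?_
  obtain ⟨q, hq, rfl⟩ := hw'
  refine Set.disjoint_left.1 hF hw ⟨fun k => M (q k), ⟨q, hq, rfl⟩, ?_⟩
  rw [flatLorentz_flattenCLE]

end Support

/-! ## The half-space spectral set and the boost geometry -/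

section Geometry

variable (d n) in
/-- The **half-space spectral set**: total momentum zero and every partial sum with
non-negative energy, `{p | ∑ⱼ pⱼ = 0, (∑_{j ≤ k} pⱼ)⁰ ≥ 0 ∀ k}` — the support
`{q_k⁰ ≥ 0}` of Osterwalder–Schrader I (1973), p. 93, in the momenta `pⱼ` and the sign
convention of `spectralSet`. [cite: OsterwalderSchraderCMP1973, §4.1 p. 93] -/
def halfSpectralSet : Set (Fin n → QuantumLattice.SpaceTime d) :=
  {p | ∑ j, p j = 0 ∧ ∀ k : Fin n, 0 ≤ (∑ j ∈ Finset.Iic k, p j) 0}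

/-- Membership in the half-space spectral set. [folklore] -/
@[simp]
theorem mem_halfSpectralSet_iff (p : Fin n → QuantumLattice.SpaceTime d) :
    p ∈ halfSpectralSet d n ↔ ∑ j, p j = 0 ∧ ∀ k : Fin n, 0 ≤ (∑ j ∈ Finset.Iic k, p j) 0 :=
  Iff.rfl

/-- `V̄₊ ⊆ {p⁰ ≥ 0}`, hence `spectralSet ⊆ halfSpectralSet`. [folklore] -/
theorem spectralSet_subset_halfSpectralSet : Literature.Analysis.FunctionSpaces.spectralSet d n ⊆ halfSpectralSet d n :=
  fun _ hp => ⟨hp.1, fun k => (norm_nonneg _).trans ((QuantumLattice.mem_closedForwardCone_iff _).1 (hp.2 k))⟩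

/-- The half-space spectral set is closed. [folklore] -/
theorem isClosed_halfSpectralSet : IsClosed (halfSpectralSet d n) := by
  have h1 : IsClosed {p : Fin n → QuantumLattice.SpaceTime d | ∑ j, p j = 0} :=
    isClosed_eq (continuous_finsetSum _ fun j _ => continuous_apply j) continuous_const
  have h2 : ∀ k : Fin n, IsClosed {p : Fin n → QuantumLattice.SpaceTime d | 0 ≤ (∑ j ∈ Finset.Iic k, p j) 0} :=
    fun k => isClosed_le continuous_const
      ((EuclideanSpace.proj (0 : Fin (d + 1))).continuous.comp
        (continuous_finsetSum _ fun j _ => continuous_apply j))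
  simpa only [halfSpectralSet, Set.setOf_and, Set.setOf_forall] using h1.inter (isClosed_iInter h2)

/-- Partial sums commute with the diagonal action. [folklore] -/
theorem sum_Iic_lorentz (M : QuantumLattice.SpaceTime d ≃L[ℝ] QuantumLattice.SpaceTime d) (p : Fin n → QuantumLattice.SpaceTime d) (k : Fin n) :
    ∑ j ∈ Finset.Iic k, M (p j) = M (∑ j ∈ Finset.Iic k, p j) := by
  rw [map_sum]

/-- **Boost geometry**: if `0 ≤ a < r` then some rapidity `χ` gives `cosh χ · a + sinh χ · r < 0`
(take `e^{2χ} < (r − a)/(r + a)`). [folklore] -/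
theorem exists_cosh_mul_add_sinh_mul_neg {a r : ℝ} (ha : 0 ≤ a) (har : a < r) :
    ∃ χ : ℝ, Real.cosh χ * a + Real.sinh χ * r < 0 := by
  have hr : 0 < r := ha.trans_lt har
  have hq : 0 < (r - a) / (r + a) := div_pos (by linarith) (by linarith)
  set χ : ℝ := Real.log ((r - a) / (r + a)) / 2 - 1 with hχ
  refine ⟨χ, ?_⟩
  have hexp : Real.exp χ * Real.exp χ < (r - a) / (r + a) := by
    rw [← Real.exp_add, show χ + χ = Real.log ((r - a) / (r + a)) + (-2) by rw [hχ]; ring,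
      Real.exp_add, Real.exp_log hq]
    have h2 : Real.exp (-2) < 1 := Real.exp_lt_one_iff.2 (by norm_num)
    nlinarith
  rw [Real.cosh_eq, Real.sinh_eq]
  have hpos : 0 < Real.exp χ := Real.exp_pos χ
  have hneg : 0 < Real.exp (-χ) := Real.exp_pos (-χ)
  have hmul : Real.exp χ * Real.exp (-χ) = 1 := by rw [← Real.exp_add, add_neg_cancel, Real.exp_zero]
  -- `e^χ (a + r) < e^{-χ} (r - a)`
  have key : Real.exp χ * (a + r) < Real.exp (-χ) * (r - a) := by
    have h1 : Real.exp χ * Real.exp χ * (r + a) < r - a := by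
      rwa [lt_div_iff₀ (by linarith : (0 : ℝ) < r + a)] at hexp
    nlinarith [mul_pos hpos hneg]
  nlinarith

/-- **Geometry of the spectral sets** (`d ≥ 1`): a configuration outside the spectral set is
moved outside the *half-space* spectral set by some restricted Lorentz transformation — a
rotation aligning the offending partial sum with `±e₁` (`exists_det_eq_one_map_eq_smul_single`)
followed by a boost along `e₁` (`exists_cosh_mul_add_sinh_mul_neg`, rapidity of the appropriate
sign). Equivalently `⋂_{M ∈ L↑₊} M • halfSpectralSet ⊆ spectralSet`. This is the "Hence" of
Osterwalder–Schrader I (1973), p. 93. [cite: OsterwalderSchraderCMP1973, §4.1 p. 93] -/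
theorem exists_lorentz_notMem_halfSpectralSet [NeZero d] {p : Fin n → QuantumLattice.SpaceTime d}
    (hp : p ∉ Literature.Analysis.FunctionSpaces.spectralSet d n) :
    ∃ M : QuantumLattice.SpaceTime d ≃L[ℝ] QuantumLattice.SpaceTime d, M ∈ QuantumLattice.restrictedLorentzGroup d ∧
      (fun k => M (p k)) ∉ halfSpectralSet d n := by
  by_cases hsum : ∑ j, p j = 0
  swap
  · refine ⟨1, (QuantumLattice.restrictedLorentzGroup d).one_mem, fun h => hsum ?_⟩
    change p ∈ halfSpectralSet d n at h
    exact h.1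
  obtain ⟨k, hk⟩ : ∃ k : Fin n, (∑ j ∈ Finset.Iic k, p j) ∉ QuantumLattice.closedForwardCone d := by
    by_contra h
    push Not at h
    exact hp ⟨hsum, h⟩
  set P := ∑ j ∈ Finset.Iic k, p j with hP
  rw [QuantumLattice.mem_closedForwardCone_iff, not_le] at hk
  by_cases hP0 : P 0 < 0
  · refine ⟨1, (QuantumLattice.restrictedLorentzGroup d).one_mem, fun h => ?_⟩
    change p ∈ halfSpectralSet d n at h
    exact absurd (h.2 k) (not_le.2 hP0)
  push Not at hP0
  -- `0 ≤ P⁰ < ‖P⃗‖`: rotate `P⃗` to `±‖P⃗‖ e₁`, then boost along `e₁`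
  set r : ℝ := ‖QuantumLattice.spaceC d P‖ with hr
  have hr0 : 0 < r := hP0.trans_lt hk
  have hv0 : QuantumLattice.spaceC d P ≠ 0 := norm_pos_iff.1 hr0
  obtain ⟨R, hRdet, hRv⟩ := exists_det_eq_one_map_eq_smul_single hv0
  obtain ⟨χ, hχ⟩ := exists_cosh_mul_add_sinh_mul_neg hP0 hk
  -- the sign of the rapidity follows the sign of the alignment
  obtain ⟨σ, hσ⟩ : ∃ σ : ℝ, Real.cosh σ * P 0 + Real.sinh σ * (R (QuantumLattice.spaceC d P)) 0 < 0 := by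
    rcases hRv with h | h
    · refine ⟨χ, ?_⟩
      rw [h]
      simpa using hχ
    · refine ⟨-χ, ?_⟩
      rw [h, Real.cosh_neg, Real.sinh_neg]
      simpa using hχ
  set Λ₁ := QuantumLattice.spatialRotation R.toContinuousLinearEquiv with hΛ₁
  set M := QuantumLattice.boost (0 : Fin d) σ * Λ₁ with hM
  have hΛ₁m : Λ₁ ∈ QuantumLattice.restrictedLorentzGroup d := spatialRotation_mem_restrictedLorentzGroup_holds R hRdet
  have hMP0 : (M P) 0 = Real.cosh σ * P 0 + Real.sinh σ * (R (QuantumLattice.spaceC d P)) 0 := by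
    rw [hM, QuantumLattice.continuousLinearEquiv_mul_apply, QuantumLattice.boost_apply, QuantumLattice.boostLin_apply, if_pos rfl, hΛ₁,
      QuantumLattice.spatialRotation_apply, QuantumLattice.ofTimeSpace_apply_zero, QuantumLattice.timeC_apply]
    simp only [LinearIsometryEquiv.coe_toContinuousLinearEquiv]
    rw [QuantumLattice.ofTimeSpace_apply_succ]
  refine ⟨M, (QuantumLattice.restrictedLorentzGroup d).mul_mem (boost_mem_restrictedLorentzGroup_holds 0 σ) hΛ₁m,
    fun h => ?_⟩
  have h2 := h.2 k
  rw [sum_Iic_lorentz, ← hP, hMP0] at h2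
  exact absurd hσ (not_lt.2 h2)

end Geometry

/-! ## The main theorem -/

section Main

/-- **Lorentz invariance upgrades half-space spectral support to the forward cone**
(Osterwalder–Schrader I (1973), §4.1 p. 93: support in `{q_k⁰ ≥ 0}` and invariance under `L↑₊`
give support in `{q_k ∈ V̄₊}`, "This is the spectrum condition (R5)"). For a tempered
distribution `T` on `(ℝ^{1+d})ⁿ`, `d ≥ 1`, invariant under the diagonal action of the
restricted Lorentz group `L↑₊` (as printed): `FourierSupportedIn T (halfSpectralSet d n)` implies
`FourierSupportedIn T (spectralSet d n)`. Transport (`apply_eq_zero_of_disjoint_image`), boost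
geometry (`exists_lorentz_notMem_halfSpectralSet`) and the sheaf property
(`SchwartzMap.isVanishingOn_iUnion`) applied to `T ∘ unflatten ∘ 𝓕⁻¹`. [cite: OsterwalderSchraderCMP1973, §4.1 p. 93] -/
theorem fourierSupportedIn_spectralSet_of_lorentzInvariant [NeZero d]
    {T : 𝓢((Fin n → QuantumLattice.SpaceTime d), ℂ) →L[ℂ] ℂ} (hT : IsLorentzInvariantDistribution T)
    (hK : FourierSupportedIn T (halfSpectralSet d n)) : FourierSupportedIn T (Literature.Analysis.FunctionSpaces.spectralSet d n) := by
  -- the functional on the Fourier side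
  set Φ : 𝓢(EuclideanSpace ℝ (Fin n × Fin (d + 1)), ℂ) →L[ℂ] 𝓢((Fin n → QuantumLattice.SpaceTime d), ℂ) :=
    (SchwartzMap.compCLMOfContinuousLinearEquiv ℂ (Literature.Analysis.FunctionSpaces.flattenCLE d n)).comp
      (FourierTransform.fourierInvCLM ℂ (𝓢(EuclideanSpace ℝ (Fin n × Fin (d + 1)), ℂ))) with hΦ
  set T' : 𝓢(EuclideanSpace ℝ (Fin n × Fin (d + 1)), ℂ) →L[ℂ] ℂ := T.comp Φ with hT'
  have hΦF : ∀ φ : 𝓢(EuclideanSpace ℝ (Fin n × Fin (d + 1)), ℂ),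
      Literature.Analysis.FunctionSpaces.flattenTest (Φ φ) = 𝓕⁻ φ := fun φ => by
    ext w
    simp [hΦ, Literature.Analysis.FunctionSpaces.flattenTest_apply]
  have hTF : ∀ F : 𝓢((Fin n → QuantumLattice.SpaceTime d), ℂ), T F = T' (𝓕 (Literature.Analysis.FunctionSpaces.flattenTest F)) := fun F => by
    simp only [hT', ContinuousLinearMap.comp_apply]
    congr 1
    ext x
    simp [hΦ, Literature.Analysis.FunctionSpaces.flattenTest_apply]
  -- the vanishing open sets `U_M = (flatten (M • K))ᶜ`
  set ι := {M : QuantumLattice.SpaceTime d ≃L[ℝ] QuantumLattice.SpaceTime d // M ∈ QuantumLattice.restrictedLorentzGroup d}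
  set U : ι → Set (EuclideanSpace ℝ (Fin n × Fin (d + 1))) := fun M =>
    (Literature.Analysis.FunctionSpaces.flattenCLE d n '' ((fun q k => (M : QuantumLattice.SpaceTime d ≃L[ℝ] QuantumLattice.SpaceTime d) (q k)) ''
      halfSpectralSet d n))ᶜ with hU
  have hUo : ∀ M, IsOpen (U M) := fun M => by
    rw [hU, isOpen_compl_iff, ← Set.image_comp]
    have : ((Literature.Analysis.FunctionSpaces.flattenCLE d n) ∘ fun (q : Fin n → QuantumLattice.SpaceTime d) k =>
        (M : QuantumLattice.SpaceTime d ≃L[ℝ] QuantumLattice.SpaceTime d) (q k)) =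
        ((QuantumLattice.lorentzDiag n (M : QuantumLattice.SpaceTime d ≃L[ℝ] QuantumLattice.SpaceTime d)).trans (Literature.Analysis.FunctionSpaces.flattenCLE d n)).toHomeomorph := by
      funext q; rfl
    rw [this]
    exact (Homeomorph.isClosed_image _).2 isClosed_halfSpectralSet
  have hvan : ∀ M, Distribution.IsVanishingOn T' (U M) := fun M φ hφ => by
    simp only [hT', ContinuousLinearMap.comp_apply]
    refine hK.apply_eq_zero_of_disjoint_image hT M.2 (Φ φ) ?_
    rw [SchwartzMap.fourierTransformCLM_apply, hΦF, fourier_fourierInv_eq]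
    exact Set.subset_compl_iff_disjoint_right.1 hφ
  have hcover : (Literature.Analysis.FunctionSpaces.flattenCLE d n '' Literature.Analysis.FunctionSpaces.spectralSet d n)ᶜ ⊆ ⋃ M, U M := fun w hw => by
    have hp : (Literature.Analysis.FunctionSpaces.flattenCLE d n).symm w ∉ Literature.Analysis.FunctionSpaces.spectralSet d n := fun h =>
      hw ⟨_, h, (Literature.Analysis.FunctionSpaces.flattenCLE d n).apply_symm_apply w⟩
    obtain ⟨M₀, hM₀, hnot⟩ := exists_lorentz_notMem_halfSpectralSet hp
    refine mem_iUnion.2 ⟨⟨M₀⁻¹, (QuantumLattice.restrictedLorentzGroup d).inv_mem hM₀⟩, ?_⟩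
    rintro ⟨q', ⟨q, hq, rfl⟩, hqw⟩
    apply hnot
    have hw' : (Literature.Analysis.FunctionSpaces.flattenCLE d n).symm w = fun k => M₀⁻¹ (q k) := by
      rw [← hqw, ContinuousLinearEquiv.symm_apply_apply]
    convert hq using 1
    funext k
    rw [hw']
    exact QuantumLattice.continuousLinearEquiv_apply_inv_apply M₀ (q k)
  intro F hF
  rw [hTF]
  exact SchwartzMap.isVanishingOn_iUnion hUo T' hvan _
    ((Set.subset_compl_iff_disjoint_right.2 hF).trans hcover)

/-- **Half-space spectral support plus `L↑₊`-invariance give the spectral condition (b)** for a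
family of distributions (Osterwalder–Schrader I (1973), §4.1 p. 93, R5); the invariance
hypothesis is the Lorentz part of axiom (a)
(`IsPoincareInvariantFamily.isLorentzInvariantDistribution`). [cite: OsterwalderSchraderCMP1973, §4.1 p. 93] -/
theorem _root_.Literature.Analysis.FunctionSpaces.WightmanFamily.hasSpectralCondition_of_halfSpace [NeZero d] {κ : Type*}
    (𝒲 : Literature.Analysis.FunctionSpaces.WightmanFamily d κ)
    (hinv : ∀ (n : ℕ) (k : Fin n → κ), IsLorentzInvariantDistribution (𝒲 n k))
    (hhalf : ∀ (n : ℕ) (k : Fin n → κ), FourierSupportedIn (𝒲 n k) (halfSpectralSet d n)) :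
    Literature.Analysis.FunctionSpaces.HasSpectralCondition 𝒲 :=
  fun n k => fourierSupportedIn_spectralSet_of_lorentzInvariant (hinv n k) (hhalf n k)

end Main

end Literature.MathematicalPhysics.QuantumFieldTheory
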